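import Summits.BirchSwinnertonDyer.BirchSwinnertonDyer.Theorems.ShaPrimaryTransferFiniteShaComponentTransferSelmerCubicCoverCl
import Summits.BirchSwinnertonDyer.BirchSwinnertonDyer.Theorems.Rank2Observatory2DescClSubgroupSieve
import HarnessLib

/-!
# BirchSwinnertonDyer — SEL2CUBIC: `#Sel⁽²⁾(E/ℚ) < 2^{r+1}` from the SUBGROUP SIEVE (noSub rows)

HONEST FRAMING: route `ShaPrimaryTransfer`, seat `bsd-line-spt-p1` (g30), `--supports` item T =
`FiniteShaComponentTransfer` (stmt-22356), UNCHANGED (conjecture-grade at corank ≥ 2). BSD in rank ≥ 2 is NOT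
proved by any of this. THEOREMS ONLY.

The Selmer-class form of the subgroup-sieve closing (`Rank2Observatory2DescClSubgroupSieve`,
`mordellWeilRank_le_of_coverSet_cl_noSub`): the rational-point version bounds the image of `E(ℚ)/2E(ℚ)` — a
multiplicatively closed subset of the cover set — by the kernel search `noSubB`; the image `Φ(Sel⁽²⁾(E/ℚ))` of the
Selmer group under the (injective, additive) Cassels map is such a subset as well, so the same search gives
`#Sel⁽²⁾(E/ℚ) < 2^{r+1}` — the strict Selmer count that closes `t₂(E) = 0 ∧ Ш(E/ℚ)[2^∞] = 0 ∧ rank E(ℚ) = r`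
(`sha_door_of_natCard_selmerGroup_two_lt`).

* `card_lt_of_mulClosed_subset_coverSet` — the counting half of `mordellWeilRank_le_of_coverSet_cl_noSub`,
  verbatim, for ANY multiplicatively closed `H ∋ 1` inside the cover set;
* **`natCard_selmerGroup_lt_of_coverSet_cl_noSub`** — `#Sel⁽²⁾(E/ℚ) < 2^{s'+1}` from a Selmer-sound sieve,
  independence of the family modulo squares, the survivor list and the `noSubB` search.
[cite: Cassels1991LecturesEllipticCurves, §15] [cite: SilvermanAEC2009, Thm. X.4.2] [cite: CremonaAlgorithms1997, §3.6]
-/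

-- single-conjunct summit: `Summit.BirchSwinnertonDyer.BirchSwinnertonDyer.…` repeats the name by design
set_option linter.dupNamespace false

noncomputable section

open scoped Classical NumberField nonZeroDivisors

open Literature.NumberTheory.NumberFields Literature.NumberTheory.EllipticCurves
  Literature.NumberTheory.GaloisRepresentations Polynomial Module NumberField IsDedekindDomain Ideal
open WeierstrassCurve WeierstrassCurve.Affine

namespace Summit.BirchSwinnertonDyer.BirchSwinnertonDyer.Theorems.ShaPrimaryTransferSelmerCubicCover

open Summit.BirchSwinnertonDyer.BirchSwinnertonDyer.Rank2Observatory
open Summit.BirchSwinnertonDyer.BirchSwinnertonDyer.Rank2Observatory.TwoDescCubic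
open Summit.BirchSwinnertonDyer.BirchSwinnertonDyer.Rank2Observatory.TwoDescCl
open Summit.BirchSwinnertonDyer.BirchSwinnertonDyer.Rank2Observatory.TwoDescCl.ClFieldCert

variable {K : Type} [Field K] [NumberField K] {A B C : ℤ} {θ : 𝓞 K} {n : ℕ}

omit [NumberField K] in
/-- **Counting half of the subgroup sieve**: a multiplicatively closed `H ∋ 1` inside the cover set of a sieve
`adm` (no unit part), with the family `W` independent modulo squares, every admissible class listed in `S` and the
search `noSubB (adm ∅ ·) S (s'+1) [∅]` succeeding, has `#H < 2^{s'+1}`. (The second half of the proof of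
`mordellWeilRank_le_of_coverSet_cl_noSub`, verbatim.) [cite: Cassels1991LecturesEllipticCurves, §15] -/
theorem card_lt_of_mulClosed_subset_coverSet {W : Fin n → 𝓞 K} (hW0 : ∀ j, W j ≠ 0)
    (hind : ∀ U : Finset (Fin n), IsSquare (∏ j ∈ U, algebraMap (𝓞 K) K (W j)) → U = ∅)
    {Wu : Fin 0 → (𝓞 K)ˣ} {adm : Finset (Fin 0) → Finset (Fin n) → Bool} (h0 : adm ∅ ∅ = true)
    {S : List (Finset (Fin n))} (hSall : ∀ U : Finset (Fin n), adm ∅ U = true → U ∈ S)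
    {s' : ℕ} (hns : noSubB (fun U => adm ∅ U) S (s' + 1) [∅] = true)
    (H : Finset (SqUnits K)) (hHS : H ⊆ coverSet Wu W adm) (hH1 : (1 : SqUnits K) ∈ H)
    (hHmul : ∀ a ∈ H, ∀ b ∈ H, a * b ∈ H) : H.card < 2 ^ (s' + 1) := by
  classical
  -- the class map `U ↦ (∏_U W)·K×²`: multiplicative in `∆`, injective by independence
  have hne : ∀ U : Finset (Fin n), (∏ j ∈ U, algebraMap (𝓞 K) K (W j)) ≠ 0 := fun U =>
    Finset.prod_ne_zero_iff.mpr fun j _ => RingOfIntegers.coe_ne_zero_iff.mpr (hW0 j)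
  have hmulc : ∀ U V : Finset (Fin n), sqClass (∏ j ∈ symmDiff U V, algebraMap (𝓞 K) K (W j)) =
      sqClass (∏ j ∈ U, algebraMap (𝓞 K) K (W j)) * sqClass (∏ j ∈ V, algebraMap (𝓞 K) K (W j)) := by
    intro U V
    refine sqClass_eq_mul_of_mul_mul_eq_sq (hne U) (hne V) (hne (symmDiff U V))
      (z := (∏ j ∈ symmDiff U V, algebraMap (𝓞 K) K (W j)) * ∏ j ∈ U ∩ V, algebraMap (𝓞 K) K (W j)) ?_
    rw [prod_mul_prod_eq_symmDiff_sq (fun j => algebraMap (𝓞 K) K (W j)) U V]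
    ring
  have hinj : ∀ U V : Finset (Fin n), sqClass (∏ j ∈ U, algebraMap (𝓞 K) K (W j)) =
      sqClass (∏ j ∈ V, algebraMap (𝓞 K) K (W j)) → U = V := by
    intro U V hUV
    have h1 : sqClass (∏ j ∈ symmDiff U V, algebraMap (𝓞 K) K (W j)) = 1 := by
      rw [hmulc, hUV, SqUnits.mul_self]
    obtain ⟨u, hu⟩ := (sqClass_eq_one_iff (hne (symmDiff U V))).mp h1
    have hsq : IsSquare (∏ j ∈ symmDiff U V, algebraMap (𝓞 K) K (W j)) := ⟨u, by rw [hu, pow_two]⟩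
    exact symmDiff_eq_bot.mp (hind _ hsq)
  have hcov : ∀ h ∈ H, ∃ U : Finset (Fin n), adm ∅ U = true ∧
      sqClass (∏ j ∈ U, algebraMap (𝓞 K) K (W j)) = h := by
    intro h hh
    obtain ⟨p, hp, rfl⟩ := Finset.mem_image.mp (hHS hh)
    have hp1 : p.1 = ∅ := Finset.eq_empty_of_isEmpty p.1
    refine ⟨p.2, ?_, ?_⟩
    · have := (Finset.mem_filter.mp hp).2
      rwa [hp1] at this
    · rw [hp1, Finset.prod_empty, one_mul]
  let P : Finset (Finset (Fin n)) := Finset.univ.filter (fun U => adm ∅ U = true ∧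
    sqClass (∏ j ∈ U, algebraMap (𝓞 K) K (W j)) ∈ H)
  have hHP : H.card ≤ P.card := by
    have hsub : H ⊆ P.image (fun U => sqClass (∏ j ∈ U, algebraMap (𝓞 K) K (W j))) := by
      intro h hh
      obtain ⟨U, hU, rfl⟩ := hcov h hh
      exact Finset.mem_image.mpr ⟨U, Finset.mem_filter.mpr ⟨Finset.mem_univ _, hU, hh⟩, rfl⟩
    exact (Finset.card_le_card hsub).trans Finset.card_image_le
  have hP0 : (∅ : Finset (Fin n)) ∈ P := by
    refine Finset.mem_filter.mpr ⟨Finset.mem_univ _, h0, ?_⟩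
    have h11 : sqClass (1 : K) = 1 := by simpa only [mul_one] using sqClass_mul_self (1 : K)
    rw [Finset.prod_empty, h11]
    exact hH1
  have hPs : ∀ U ∈ P, adm ∅ U = true := fun U hU => (Finset.mem_filter.mp hU).2.1
  have hPS : ∀ U ∈ P, U ∈ S := fun U hU => hSall U (hPs U hU)
  have hPc : ∀ U ∈ P, ∀ V ∈ P, symmDiff U V ∈ P := by
    intro U hU V hV
    have hUV : sqClass (∏ j ∈ symmDiff U V, algebraMap (𝓞 K) K (W j)) ∈ H := by
      rw [hmulc]
      exact hHmul _ (Finset.mem_filter.mp hU).2.2 _ (Finset.mem_filter.mp hV).2.2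
    obtain ⟨U', hU', hcls⟩ := hcov _ hUV
    have hUU : U' = symmDiff U V := hinj _ _ hcls
    refine Finset.mem_filter.mpr ⟨Finset.mem_univ _, ?_, hUV⟩
    rwa [hUU] at hU'
  have hlt := card_lt_of_noSubB (fun U => adm ∅ U) S P hP0 hPs hPS hPc (s' + 1) [∅]
    (fun V hV => by rw [List.mem_singleton.mp hV]; exact hP0) hns
  simp only [List.length_singleton, mul_one] at hlt
  exact lt_of_le_of_lt hHP hlt

/-- **`#Sel⁽²⁾(E/ℚ) < 2^{s'+1}` from the subgroup sieve.** As `natCard_selmerGroup_le_of_coverSet_cl` (the sieve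
`adm` accepts the Cassels class of every `2`-Selmer class), closed by the subgroup-sieve search instead of the
plain count: the image `Φ(Sel⁽²⁾(E/ℚ))` (`Φ` the injective additive one-root descent map composed with Kummer
theory) is a multiplicatively closed subset of the cover set containing `1`, hence has fewer than `2^{s'+1}`
elements by `card_lt_of_mulClosed_subset_coverSet`. The Selmer-class form of
`mordellWeilRank_le_of_coverSet_cl_noSub`. [cite: Cassels1991LecturesEllipticCurves, §15]
[cite: SilvermanAEC2009, Thm. X.4.2] -/
theorem natCard_selmerGroup_lt_of_coverSet_cl_noSub (E : WeierstrassCurve ℚ) [E.IsElliptic]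
    (ha₁ : E.a₁ = 0) (ha₂ : E.a₂ = A) (ha₃ : E.a₃ = 0) (ha₄ : E.a₄ = B) (ha₆ : E.a₆ = C)
    (hirr : Irreducible (MonicCubic.polyQ A B C))
    (hθ : aeval (algebraMap (𝓞 K) K θ) (MonicCubic.poly A B C) = 0) (h3 : finrank ℚ K = 3)
    [(E.baseChange K).IsElliptic]
    {M : 𝓞 K} (hM : M ≠ 0)
    (hgen : Subgroup.closure {c : ClassGroup (𝓞 K) | ∃ (J : Ideal (𝓞 K))
      (hJ : J ∈ (Ideal (𝓞 K))⁰), M ∈ J ∧ ClassGroup.mk0 ⟨J, hJ⟩ = c} = ⊤)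
    (hDM : ∀ v : HeightOneSpectrum (𝓞 K),
      (3 : 𝓞 K) * θ ^ 2 + 2 * (A : 𝓞 K) * θ + (B : 𝓞 K) ∈ v.asIdeal → M ∈ v.asIdeal)
    {W : Fin n → 𝓞 K} (hW0 : ∀ j, W j ≠ 0)
    (hW : ∀ u : K, u ≠ 0 →
      (∀ v : HeightOneSpectrum (𝓞 K), M ∉ v.asIdeal → v.valuation K u = 1) →
      ∃ U : Finset (Fin n), IsSquare (u * ∏ j ∈ U, algebraMap (𝓞 K) K (W j)))
    {Wu : Fin 0 → (𝓞 K)ˣ} {adm : Finset (Fin 0) → Finset (Fin n) → Bool} (h0 : adm ∅ ∅ = true)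
    (hadm : ∀ c ∈ selmerGroup E 2, ∀ a : Kˣ,
      kummerEquiv K 2 (E.oneRootDescentH1 K (isTwoTorsionX_of_aeval E ha₁ ha₂ ha₃ ha₄ ha₆ hθ) c) =
        Additive.ofMul (QuotientGroup.mk a) →
      ∀ (T : Finset (Fin 0)) (U : Finset (Fin n)),
        IsSquare ((a : K) * (∏ i ∈ T, algebraMap (𝓞 K) K (Wu i)) * ∏ j ∈ U, algebraMap (𝓞 K) K (W j)) →
        adm T U = true)
    (hind : ∀ U : Finset (Fin n), IsSquare (∏ j ∈ U, algebraMap (𝓞 K) K (W j)) → U = ∅)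
    {S : List (Finset (Fin n))} (hSall : ∀ U : Finset (Fin n), adm ∅ U = true → U ∈ S)
    {s' : ℕ} (hns : noSubB (fun U => adm ∅ U) S (s' + 1) [∅] = true) :
    Nat.card (selmerGroup E 2) < 2 ^ (s' + 1) := by
  set hθ' := isTwoTorsionX_of_aeval E ha₁ ha₂ ha₃ ha₄ ha₆ hθ
  set Φ : galH1Torsion E 2 → SqUnits K := fun c => Additive.toMul (kummerEquiv K 2 (E.oneRootDescentH1 K hθ' c))
    with hΦ
  have hΦinj : Function.Injective Φ := by
    intro c c' h
    have h' : kummerEquiv K 2 (E.oneRootDescentH1 K hθ' c) = kummerEquiv K 2 (E.oneRootDescentH1 K hθ' c') :=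
      Additive.toMul.injective h
    exact E.oneRootDescentH1_injective (irreducible_twoDivision E ha₁ ha₂ ha₃ ha₄ ha₆ hirr) h3 hθ'
      ((kummerEquiv K 2).injective h')
  have hmem : ∀ c ∈ selmerGroup E 2, Φ c ∈ coverSet Wu W adm := by
    intro c hc
    obtain ⟨a, haΦ⟩ := QuotientGroup.mk_surjective (Φ c)
    have ha : kummerEquiv K 2 (E.oneRootDescentH1 K hθ' c) = Additive.ofMul (QuotientGroup.mk a) := by
      rw [haΦ]; rfl
    obtain ⟨U, hsqU⟩ := exists_isSquare_descent_value_cl_sel E ha₁ ha₂ ha₃ ha₄ ha₆ hθ hM hgen hDM hW hc a ha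
    have hsq : IsSquare ((a : K) * (∏ i ∈ (∅ : Finset (Fin 0)), algebraMap (𝓞 K) K (Wu i)) *
        ∏ j ∈ U, algebraMap (𝓞 K) K (W j)) := by
      simpa only [Finset.prod_empty, mul_one] using hsqU
    refine Finset.mem_image.mpr ⟨(∅, U), Finset.mem_filter.mpr
      ⟨Finset.mem_product.mpr ⟨Finset.mem_univ _, Finset.mem_univ _⟩, hadm c hc a ha ∅ U hsq⟩, ?_⟩
    set z := (∏ i ∈ (∅ : Finset (Fin 0)), algebraMap (𝓞 K) K (Wu i)) * ∏ j ∈ U, algebraMap (𝓞 K) K (W j)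
      with hzdef
    have hz : z ≠ 0 := by
      refine mul_ne_zero (Finset.prod_ne_zero_iff.mpr fun i _ => ?_) (Finset.prod_ne_zero_iff.mpr fun j _ => ?_)
      · exact RingOfIntegers.coe_ne_zero_iff.mpr (Units.ne_zero (Wu i))
      · exact RingOfIntegers.coe_ne_zero_iff.mpr (hW0 j)
    obtain ⟨r, hr⟩ := hsq
    have hξ : sqClass (a : K) = Φ c := by rw [← haΦ, sqClass_of_ne_zero a.ne_zero, Units.mk0_val]
    have hprod : sqClass (a : K) * sqClass z = 1 := by
      rw [← sqClass_mul a.ne_zero hz, hzdef, ← mul_assoc, hr, sqClass_mul_self]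
    show sqClass z = Φ c
    rw [← hξ]
    calc sqClass z = 1 * sqClass z := (SqUnits.one_mul _).symm
      _ = sqClass (a : K) * sqClass (a : K) * sqClass z := by rw [SqUnits.mul_self]
      _ = sqClass (a : K) * (sqClass (a : K) * sqClass z) := by rw [mul_assoc]
      _ = sqClass (a : K) := by rw [hprod, SqUnits.mul_one]
  haveI : Finite (selmerGroup E 2) := E.finite_selmerGroup_holds (by norm_num : (2 : ℤ) ≠ 0)
  haveI : Fintype (selmerGroup E 2) := Fintype.ofFinite _
  let H : Finset (SqUnits K) := Finset.univ.image (fun c : selmerGroup E 2 => Φ c.1)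
  have hcard : Nat.card (selmerGroup E 2) = H.card := by
    rw [Nat.card_eq_fintype_card,
      Finset.card_image_of_injective _ (fun c c' h => Subtype.ext (hΦinj h)), Finset.card_univ]
  have hHS : H ⊆ coverSet Wu W adm := by
    intro h hh
    obtain ⟨c, -, rfl⟩ := Finset.mem_image.mp hh
    exact hmem c.1 c.2
  have hH1 : (1 : SqUnits K) ∈ H := by
    refine Finset.mem_image.mpr ⟨⟨0, zero_mem _⟩, Finset.mem_univ _, ?_⟩
    simp only [hΦ, map_zero, toMul_zero]
  have hHmul : ∀ a ∈ H, ∀ b ∈ H, a * b ∈ H := by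
    intro a ha b hb
    obtain ⟨c, -, rfl⟩ := Finset.mem_image.mp ha
    obtain ⟨c', -, rfl⟩ := Finset.mem_image.mp hb
    refine Finset.mem_image.mpr ⟨⟨c.1 + c'.1, add_mem c.2 c'.2⟩, Finset.mem_univ _, ?_⟩
    simp only [hΦ, map_add, toMul_add]
  rw [hcard]
  exact card_lt_of_mulClosed_subset_coverSet hW0 hind h0 hSall hns H hHS hH1 hHmul

end Summit.BirchSwinnertonDyer.BirchSwinnertonDyer.Theorems.ShaPrimaryTransferSelmerCubicCover

end
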